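/-
Origin: expansion seat `planner-pub-hodgecm-prl1-g5-0`, handover #4 2026-08-18T09:25:29Z (`HOME/pub-hodgecm-prl1-g5/lean/Prl1g5/N12bSignRecipe.lean`, md5 a97023e7, 98 lines);
landed by the gen-7 packager in gate run 27 as `HodgeCM/PerL34/N12bSignRecipe.lean` (import ^import Prl1g5\.→import HodgeCM.Automorphic. ×1).
-/
/-
Origin: HOME/pub-hodgecm-prl1-g5/lean/Prl1g5/N12bSignRecipe.lean — session planner-pub-hodgecm-prl1-g5-0 (unit
pub-hodgecm-prl1-g5, EXPANSION PROVER a-1 gen 5, STRATEGY 1 = CONSTRUCT).  Intended final place: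
`HodgeCM/PerL34/N12bSignRecipe.lean`.  Imports at landing: tree `HodgeCM.PerL34.Assembly`, `HodgeCM.Proofs.LandherrDischarge`
and `Prl1g5.SignRecipe` ↦ `HodgeCM.Automorphic.SignRecipe` (this seat's #1).
-/
import Summits.HodgeConjecture.HodgeCM.PerL34.Assembly
import Summits.HodgeConjecture.HodgeCM.Proofs.LandherrDischarge
import Summits.HodgeConjecture.HodgeCM.Automorphic.SignRecipe_2

/-!
# DAG node N12b (`N12b_signRecipe T`, the sign recipe's two conjugation equivariances) DISCHARGED BY CONSTRUCTION

The carver's node `PerL34.N12b_signRecipe T := T.Design_kappaConj ∧ T.Design_frameSignConj` (PerL v5 Lemma 3.3(a)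
ll. 283–284 / (eq:Psit) ll. 61–65; `PerL34/Allowed.lean`) is a binder `h12b` of every DAG assembly
(`PerL34.Assembly.perL_of_nodes`, `AssemblyLeaves`, `AssemblyRoutes`, `EndStateHCCM`, …).  It is a DESIGN constraint on
the model's free sign data; with PerL's recipe constructed (`HodgeCM.Automorphic.SignRecipe`) it is a theorem:

* `ThetaModel.withSignRecipe T h` — any theta model RE-SIGNED with PerL's recipe (`kappa := SignRecipe.kappa h`,
  `frameSign := SignRecipe.frameSign`; every other primitive unchanged, definitionally);
* `PerL34.N12b_signRecipe_of_eq` / `N12b_signRecipe_withSignRecipe : N12b_signRecipe (T.withSignRecipe h)` — NO hypothesis;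
* `PerL34.perL_of_nodes_signRecipe` — N34 (`U.PerL`) from the DAG nodes with `h12b` AND `h14` (Landherr, in-tree since
  run 22) GONE: binders `M`, `h`, `h07`, `h09a/h09b` (about `emb`/`cover` only — the same statements for `T` and for
  `T.withSignRecipe h`), and the six OPEN nodes N12a/N19w/N19g/N29/N31/N33 stated for the re-signed model (they are
  conditioned on good contexts, which now carry PerL's ACTUAL forced signs).
-/

noncomputable section

namespace HodgeCM

namespace Universe.ThetaModel

variable {U : Universe} (T : U.ThetaModel) (h : Bool)

/-- **A theta model re-signed with PerL's sign recipe** (`φ^h ∈ {1, c}` the convention bit). -/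
def withSignRecipe : U.ThetaModel :=
  { T with kappa := SignRecipe.kappa h, frameSign := SignRecipe.frameSign }

/-- (Ported verbatim from the HodgeCMPerL package; no docstring in the source.) -/
@[simp] theorem withSignRecipe_kappa : (T.withSignRecipe h).kappa = SignRecipe.kappa h := rfl
/-- (Ported verbatim from the HodgeCMPerL package; no docstring in the source.) -/
@[simp] theorem withSignRecipe_frameSign : (T.withSignRecipe h).frameSign = SignRecipe.frameSign := rfl

/-- The two PRINT-interface facts about `emb`/`cover` are literally the same statements for `T` and its re-signing. -/
theorem fact_embCover_withSignRecipe_iff : (T.withSignRecipe h).Fact_embCover ↔ T.Fact_embCover := Iff.rfl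
/-- (Ported verbatim from the HodgeCMPerL package; no docstring in the source.) -/
theorem fact_innerEmb_withSignRecipe_iff : (T.withSignRecipe h).Fact_innerEmb ↔ T.Fact_innerEmb := Iff.rfl

/-- (Ported verbatim from the HodgeCMPerL package; no docstring in the source.) -/
theorem design_kappaConj_withSignRecipe : (T.withSignRecipe h).Design_kappaConj :=
  (T.withSignRecipe h).design_kappaConj_of_eq h rfl

/-- (Ported verbatim from the HodgeCMPerL package; no docstring in the source.) -/
theorem design_frameSignConj_withSignRecipe : (T.withSignRecipe h).Design_frameSignConj :=
  (T.withSignRecipe h).design_frameSignConj_of_eq rfl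

/-- Re-signing a model whose sign data already are the recipe changes nothing. -/
theorem withSignRecipe_eq_self (hk : T.kappa = SignRecipe.kappa h) (hf : T.frameSign = SignRecipe.frameSign) :
    T.withSignRecipe h = T := by
  cases T; cases hk; cases hf; rfl

end Universe.ThetaModel

namespace PerL34

variable {U : Universe} (T : U.ThetaModel) (h : Bool)

/-- **N12b for any theta model whose sign data are PerL's recipe** — a theorem, no hypothesis beyond the two equations. -/
theorem N12b_signRecipe_of_eq (hk : T.kappa = SignRecipe.kappa h) (hf : T.frameSign = SignRecipe.frameSign) :
    N12b_signRecipe T :=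
  ⟨T.design_kappaConj_of_eq h hk, T.design_frameSignConj_of_eq hf⟩

/-- **N12b for the re-signed model — OUTRIGHT.** -/
theorem N12b_signRecipe_withSignRecipe : N12b_signRecipe (T.withSignRecipe h) :=
  N12b_signRecipe_of_eq _ h rfl rfl

/-- (Ported verbatim from the HodgeCMPerL package; no docstring in the source.) -/
theorem N09a_withSignRecipe_iff : N09a_embCover (T.withSignRecipe h) ↔ N09a_embCover T := Iff.rfl
/-- (Ported verbatim from the HodgeCMPerL package; no docstring in the source.) -/
theorem N09b_withSignRecipe_iff : N09b_innerEmb (T.withSignRecipe h) ↔ N09b_innerEmb T := Iff.rfl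

/-- **N34 = PerL v5 Theorem 4.4 from the DAG nodes, with N12b (sign recipe) and N14 (Landherr) DISCHARGED.**
Compare `perL_of_nodes`: the binders `h12b : N12b_signRecipe T` and `h14 : N14_landherr` are gone; the model is
re-signed with PerL's recipe (`h` = `φ^h ∈ {1, c}`), the PRINT-interface nodes N09a/N09b are stated for `T` itself
(same statements), the six OPEN nodes for the re-signed model. -/
theorem perL_of_nodes_signRecipe (M : U.ModelAxioms) (T : U.ThetaModel) (h : Bool)
    (h07 : N07_hodgeRiemann20 U) (h09a : N09a_embCover T) (h09b : N09b_innerEmb T)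
    (h12a : N12a_thetaSub (T.withSignRecipe h))
    (h19w : N19w_wedgeMem (T.withSignRecipe h)) (h19g : N19g_genInWedgeSpan (T.withSignRecipe h))
    (h29 : N29_occ (T.withSignRecipe h)) (h31 : N31_chars (T.withSignRecipe h))
    (h33 : N33_wedge (T.withSignRecipe h)) : U.PerL :=
  perL_of_nodes M (T.withSignRecipe h) h07 ((N09a_withSignRecipe_iff T h).2 h09a)
    ((N09b_withSignRecipe_iff T h).2 h09b) h12a (N12b_signRecipe_withSignRecipe T h) N14_landherr_holds
    h19w h19g h29 h31 h33

/-- The ten `Inputs` of the re-signed model from its eight non-design inputs. -/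
theorem inputs_withSignRecipe (A : (T.withSignRecipe h).NonDesignInputs) : (T.withSignRecipe h).Inputs :=
  A.toInputs (T.design_kappaConj_withSignRecipe h) (T.design_frameSignConj_withSignRecipe h)

end PerL34

end HodgeCM

end
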